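import Summits.Ventures.Crystal3D.Theorems.StickyWulffConstantGenericWallFloorStackWalkRay
import Summits.Ventures.Crystal3D.Theorems.StickyWulffConstantGenericWallFloorStackWalkReverse
import HarnessLib

/-!
# Chain frames are word frames: the forced ray as an admissible model mirror word

HONEST FRAMING. Part of the venture `Summits/Ventures/Crystal3D` (cell `crystal3d-full`), helper `--supports` the
crux `GenericWallFloor` (stmt-Ventures-19480) of `route-Ventures-StickyWulffConstant`, registered line `WallLedgerG`,
open stub `stub_twoSlabAdhesion`.  This is the first file of the WORD HALF of the planner's «cap localisation» G-CL
(cf-p1 DECISION (l), 2026-08-28): a ray-aligned pair is to be read as ONE `Σ3ⁿ` misorientation word.  The residual of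
lane G (`GenericWallFloorCore`) quantifies over `chainFrames z A u` — the frame `A` and the frames of the two FORCED RAYS
`forcedTop z ⟨A, u, 0⟩ n k` (`…StackWalkForcedChain`) — but the tree only knew the forced ray as an abstract recursion
(`pushEntry` through `nextNormal`); everything proved about entry normals being unit `{111}` menu normals was proved for
REALISED stacks (`StackSound`), where the menu property is read off the cap.  Here the forced ray is shown to be sound on
its own, and its frames are identified with the frames of an explicit ADMISSIBLE MODEL WORD.

* `menu_twoSlot_sub` — the geometric input: for a unit menu normal `n` of a frame `F` and a slot `d` with
  `⟪F d, n⟫ = √(2/3)`, the second normal through `d`, `2√(2/3)·F d − n`, is again a menu normal of `F` (slot case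
  analysis: a positive and a negative slot of one `{111}` normal are never adjacent); `norm_twoSlot_sub`: it is a unit
  vector; `inner_twoSlot_sub`: it meets `n` at `1/3`.
* `pushEntry_menu`, **`forcedTop_menu`** — every level of the forced ray over a unit menu normal of the bottom frame has a
  unit entry normal which is a menu normal of its frame, a slot direction, and `⟪F_k d_k, n_k⟫ = √(2/3)` (the abstract
  ray need NOT be `StackSound` — the rise conditions are about realised walks — so `frame_eq_wordFrame` /
  `stackWord_letters` do not apply to it; this is their replacement).
* **`forcedTop_frame_eq_wordFrame`** — `(forcedTop z b n k).frame = wordFrame b.frame (rayWord z b n (k + 1))` for the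
  tree's RAY WORD (`…StackWalkRay`: the entry normals pulled back through the frame below, most recent first;
  `twinFrame_eq_reflection_trans` iterated); **`rayWord_letters`**: its letters are unit model menu normals and consecutive
  letters meet at `−1/3` (so the word is reduced); `getLast?_rayWord_succ`: its LAST letter (the first push, applied
  first) is `b.frame.symm n`.
* **`exists_word_of_mem_chainFrames`** — hence every `F ∈ chainFrames z A u` is `wordFrame A κ` for an admissible
  reduced word `κ` which is empty or ends with a letter `μ` adjacent to the launch slot: `⟪u, μ⟫ = √(2/3)`.

The second file of the word half (`…RayAlignedWord`) turns a co-axial coincidence between chain frames of the two grains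
into one reduced word relating `A₂·Λ₀` to `A₁·Λ₀`.

WHAT THIS IS NOT: not the stub; no counting; F-C1 not moved.  No cap localisation yet — this is its vocabulary.
-/

noncomputable section

namespace Summit.Ventures.Crystal3D.Theorems

open Summit.Ventures.Crystal3D Finset
open Literature.MathematicalPhysics.StatisticalMechanics (fccStacking)
open scoped InnerProductSpace

/-! ### The second `{111}` normal through a positive slot -/

/-- **The second normal through a positive slot is a menu normal.**  For a unit menu normal `n` of `F` and a slot `d`
with `⟪F d, n⟫ = √(2/3)`, the vector `2√(2/3)·F d − n` is a menu normal of `F`. -/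
theorem menu_twoSlot_sub (F : EuclideanSpace ℝ (Fin 3) ≃ₗᵢ[ℝ] EuclideanSpace ℝ (Fin 3))
    {n d : EuclideanSpace ℝ (Fin 3)} (hn : ‖n‖ = 1)
    (hmenu : ∀ w ∈ fccSlots, ⟪F w, n⟫_ℝ = 0 ∨ ⟪F w, n⟫_ℝ = Real.sqrt (2 / 3) ∨ ⟪F w, n⟫_ℝ = -Real.sqrt (2 / 3))
    (hd : d ∈ fccSlots) (hdn : ⟪F d, n⟫_ℝ = Real.sqrt (2 / 3)) :
    ∀ w ∈ fccSlots, ⟪F w, (2 * Real.sqrt (2 / 3)) • F d - n⟫_ℝ = 0 ∨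
      ⟪F w, (2 * Real.sqrt (2 / 3)) • F d - n⟫_ℝ = Real.sqrt (2 / 3) ∨
      ⟪F w, (2 * Real.sqrt (2 / 3)) • F d - n⟫_ℝ = -Real.sqrt (2 / 3) := by
  intro w hw
  have hr : 0 < Real.sqrt (2 / 3) := Real.sqrt_pos.2 (by norm_num)
  have hd1 : ‖d‖ = 1 := norm_eq_one_of_mem_fccSlots hd
  have hw1 : ‖w‖ = 1 := norm_eq_one_of_mem_fccSlots hw
  have e : ⟪F w, (2 * Real.sqrt (2 / 3)) • F d - n⟫_ℝ = 2 * Real.sqrt (2 / 3) * ⟪w, d⟫_ℝ - ⟪F w, n⟫_ℝ := by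
    rw [inner_sub_right, real_inner_smul_right, LinearIsometryEquiv.inner_map_map]
  rw [e]
  have hposd : 0 < ⟪F d, n⟫_ℝ := by rw [hdn]; exact hr
  rcases inner_slots_mem hw hd with h | h | h | h | h
  · -- `w = d`
    have hwd : w = d := (inner_eq_one_iff_of_norm_eq_one (𝕜 := ℝ) hw1 hd1).1 h
    right; left; rw [h, hwd, hdn]; ring
  · -- adjacent slots: `w` is not negative
    rcases hmenu w hw with h' | h' | h'
    · right; left; rw [h, h']; ring
    · left; rw [h, h']; ring
    · exfalso
      have hnw : -w ∈ fccSlots := neg_mem_fccSlots hw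
      have hposw : 0 < ⟪F (-w), n⟫_ℝ := by rw [map_neg, inner_neg_left, h', neg_neg]; exact hr
      have hne : -w ≠ d := by
        intro hwd
        rw [← hwd, inner_neg_right, real_inner_self_eq_norm_sq, hw1] at h; norm_num at h
      have h2 := inner_eq_half_of_pos_pos F hn hmenu hnw hd hne hposw hposd
      rw [inner_neg_left, h] at h2; norm_num at h2
  · -- orthogonal slots
    rcases hmenu w hw with h' | h' | h'
    · left; rw [h, h']; ring
    · right; right; rw [h, h']; ring
    · right; left; rw [h, h']; ring
  · -- slots at `120°`: `w` is not positive
    rcases hmenu w hw with h' | h' | h'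
    · right; right; rw [h, h']; ring
    · exfalso
      have hposw : 0 < ⟪F w, n⟫_ℝ := by rw [h']; exact hr
      have hne : w ≠ d := by
        intro hwd
        rw [hwd, real_inner_self_eq_norm_sq, hd1] at h; norm_num at h
      have h2 := inner_eq_half_of_pos_pos F hn hmenu hw hd hne hposw hposd
      rw [h] at h2; norm_num at h2
    · left; rw [h, h']; ring
  · -- `w = −d`
    have hwd : w = -d := by
      have h1 : ⟪w, -d⟫_ℝ = 1 := by rw [inner_neg_right, h, neg_neg]
      exact (inner_eq_one_iff_of_norm_eq_one (𝕜 := ℝ) hw1 (by rw [norm_neg, hd1])).1 h1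
    right; right; rw [h, hwd, map_neg, inner_neg_left, hdn]; ring

/-- The second normal through a positive slot is a unit vector. -/
theorem norm_twoSlot_sub (F : EuclideanSpace ℝ (Fin 3) ≃ₗᵢ[ℝ] EuclideanSpace ℝ (Fin 3))
    {n d : EuclideanSpace ℝ (Fin 3)} (hn : ‖n‖ = 1) (hd : d ∈ fccSlots) (hdn : ⟪F d, n⟫_ℝ = Real.sqrt (2 / 3)) :
    ‖(2 * Real.sqrt (2 / 3)) • F d - n‖ = 1 := by
  have hFd : ‖F d‖ = 1 := by rw [LinearIsometryEquiv.norm_map, norm_eq_one_of_mem_fccSlots hd]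
  have h2 : ‖(2 * Real.sqrt (2 / 3)) • F d - n‖ ^ 2 = 1 ^ 2 := by
    rw [norm_sub_sq_real, real_inner_smul_left, hdn, norm_smul, hFd, hn, mul_one, Real.norm_eq_abs, sq_abs]; ring
  exact (sq_eq_sq₀ (norm_nonneg _) zero_le_one).1 h2

/-- The two normals through a positive slot meet at `1/3`. -/
theorem inner_twoSlot_sub (F : EuclideanSpace ℝ (Fin 3) ≃ₗᵢ[ℝ] EuclideanSpace ℝ (Fin 3))
    {n d : EuclideanSpace ℝ (Fin 3)} (hn : ‖n‖ = 1) (hdn : ⟪F d, n⟫_ℝ = Real.sqrt (2 / 3)) :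
    ⟪(2 * Real.sqrt (2 / 3)) • F d - n, n⟫_ℝ = 1 / 3 := by
  have h23 : Real.sqrt (2 / 3) * Real.sqrt (2 / 3) = 2 / 3 := Real.mul_self_sqrt (by norm_num)
  rw [inner_sub_left, real_inner_smul_left, hdn, real_inner_self_eq_norm_sq, hn]; nlinarith [h23]

/-- Pulling the mirror normal back through the twin frame: `(twinFrame G m)⁻¹ m = −G⁻¹ m`. -/
theorem symm_twinFrame_self (G : EuclideanSpace ℝ (Fin 3) ≃ₗᵢ[ℝ] EuclideanSpace ℝ (Fin 3))
    {m : EuclideanSpace ℝ (Fin 3)} (hm : ‖m‖ = 1) : (twinFrame G m).symm m = -G.symm m := by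
  apply (twinFrame G m).injective
  rw [LinearIsometryEquiv.apply_symm_apply, map_neg, twinFrame_apply G hm, LinearIsometryEquiv.apply_symm_apply,
    real_inner_self_eq_norm_sq, hm]
  module

/-! ### The forced ray is sound -/

/-- **One push is sound.**  Pushing any entry through a unit menu normal `m` of its frame gives an entry whose normal is
`m`, a menu normal of the new (twin) frame, whose direction is a slot, positive at `√(2/3)`. -/
theorem pushEntry_menu (z : EuclideanSpace ℝ (Fin 3)) (e : WalkEntry) {m : EuclideanSpace ℝ (Fin 3)} (hm : ‖m‖ = 1)
    (hmenu : ∀ w ∈ fccSlots, ⟪e.frame w, m⟫_ℝ = 0 ∨ ⟪e.frame w, m⟫_ℝ = Real.sqrt (2 / 3) ∨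
      ⟪e.frame w, m⟫_ℝ = -Real.sqrt (2 / 3)) :
    ‖(pushEntry z e m).nrm‖ = 1 ∧
    (∀ w ∈ fccSlots, ⟪(pushEntry z e m).frame w, (pushEntry z e m).nrm⟫_ℝ = 0 ∨
      ⟪(pushEntry z e m).frame w, (pushEntry z e m).nrm⟫_ℝ = Real.sqrt (2 / 3) ∨
      ⟪(pushEntry z e m).frame w, (pushEntry z e m).nrm⟫_ℝ = -Real.sqrt (2 / 3)) ∧
    (pushEntry z e m).dir ∈ fccSlots ∧
    ⟪(pushEntry z e m).frame (pushEntry z e m).dir, (pushEntry z e m).nrm⟫_ℝ = Real.sqrt (2 / 3) := by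
  simp only [pushEntry]
  have hr : 0 < Real.sqrt (2 / 3) := Real.sqrt_pos.2 (by norm_num)
  have hF' : ∀ x, twinFrame e.frame m x = e.frame x - (2 * ⟪e.frame x, m⟫_ℝ) • m := twinFrame_apply e.frame hm
  have hmenu' := menu_reflect e.frame (twinFrame e.frame m) hm hmenu hF'
  obtain ⟨p, hp, hpm, -⟩ := exists_pos_slot_ne (twinFrame e.frame m) hm hmenu' 0
  have hne : (fccSlots.filter fun q => 0 < ⟪twinFrame e.frame m q, m⟫_ℝ).Nonempty :=
    ⟨p, mem_filter.2 ⟨hp, by rw [hpm]; exact hr⟩⟩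
  obtain ⟨hq, -⟩ := bestCapper_spec (twinFrame e.frame m) m z hne
  obtain ⟨hqS, hqpos⟩ := mem_filter.1 hq
  refine ⟨hm, hmenu', hqS, ?_⟩
  rcases hmenu' _ hqS with h | h | h
  · rw [h] at hqpos; exact absurd hqpos (lt_irrefl 0)
  · exact h
  · rw [h] at hqpos; linarith

/-- **The forced ray is sound.**  Over a bottom entry `b` and a unit menu normal `n` of `b.frame`, every level
`e_k = forcedTop z b n k` has a unit entry normal which is a menu normal of its own frame, a slot direction `d_k`, and
`⟪F_k d_k, n_k⟫ = √(2/3)`. -/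
theorem forcedTop_menu (z : EuclideanSpace ℝ (Fin 3)) (b : WalkEntry) {n : EuclideanSpace ℝ (Fin 3)} (hn : ‖n‖ = 1)
    (hmenu : ∀ w ∈ fccSlots, ⟪b.frame w, n⟫_ℝ = 0 ∨ ⟪b.frame w, n⟫_ℝ = Real.sqrt (2 / 3) ∨
      ⟪b.frame w, n⟫_ℝ = -Real.sqrt (2 / 3)) :
    ∀ k : ℕ, ‖(forcedTop z b n k).nrm‖ = 1 ∧
      (∀ w ∈ fccSlots, ⟪(forcedTop z b n k).frame w, (forcedTop z b n k).nrm⟫_ℝ = 0 ∨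
        ⟪(forcedTop z b n k).frame w, (forcedTop z b n k).nrm⟫_ℝ = Real.sqrt (2 / 3) ∨
        ⟪(forcedTop z b n k).frame w, (forcedTop z b n k).nrm⟫_ℝ = -Real.sqrt (2 / 3)) ∧
      (forcedTop z b n k).dir ∈ fccSlots ∧
      ⟪(forcedTop z b n k).frame (forcedTop z b n k).dir, (forcedTop z b n k).nrm⟫_ℝ = Real.sqrt (2 / 3)
  | 0 => pushEntry_menu z b hn hmenu
  | k + 1 => by
    obtain ⟨hn', hmenu', hdir, hpos⟩ := forcedTop_menu z b hn hmenu k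
    exact pushEntry_menu z (forcedTop z b n k) (norm_twoSlot_sub _ hn' hdir hpos)
      (menu_twoSlot_sub _ hn' hmenu' hdir hpos)

/-- The forced next normal is a unit vector. -/
theorem norm_nextNormal_forcedTop (z : EuclideanSpace ℝ (Fin 3)) (b : WalkEntry) {n : EuclideanSpace ℝ (Fin 3)}
    (hn : ‖n‖ = 1)
    (hmenu : ∀ w ∈ fccSlots, ⟪b.frame w, n⟫_ℝ = 0 ∨ ⟪b.frame w, n⟫_ℝ = Real.sqrt (2 / 3) ∨
      ⟪b.frame w, n⟫_ℝ = -Real.sqrt (2 / 3)) (k : ℕ) :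
    ‖nextNormal (forcedTop z b n k)‖ = 1 := by
  obtain ⟨hn', -, hdir, hpos⟩ := forcedTop_menu z b hn hmenu k
  exact norm_twoSlot_sub _ hn' hdir hpos

/-- The forced next normal is a menu normal of the level's frame. -/
theorem menu_nextNormal_forcedTop (z : EuclideanSpace ℝ (Fin 3)) (b : WalkEntry) {n : EuclideanSpace ℝ (Fin 3)}
    (hn : ‖n‖ = 1)
    (hmenu : ∀ w ∈ fccSlots, ⟪b.frame w, n⟫_ℝ = 0 ∨ ⟪b.frame w, n⟫_ℝ = Real.sqrt (2 / 3) ∨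
      ⟪b.frame w, n⟫_ℝ = -Real.sqrt (2 / 3)) (k : ℕ) :
    ∀ w ∈ fccSlots, ⟪(forcedTop z b n k).frame w, nextNormal (forcedTop z b n k)⟫_ℝ = 0 ∨
      ⟪(forcedTop z b n k).frame w, nextNormal (forcedTop z b n k)⟫_ℝ = Real.sqrt (2 / 3) ∨
      ⟪(forcedTop z b n k).frame w, nextNormal (forcedTop z b n k)⟫_ℝ = -Real.sqrt (2 / 3) := by
  obtain ⟨hn', hmenu', hdir, hpos⟩ := forcedTop_menu z b hn hmenu k
  exact menu_twoSlot_sub _ hn' hmenu' hdir hpos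

/-- Consecutive normals of the forced ray meet at `1/3`. -/
theorem inner_nextNormal_forcedTop (z : EuclideanSpace ℝ (Fin 3)) (b : WalkEntry) {n : EuclideanSpace ℝ (Fin 3)}
    (hn : ‖n‖ = 1)
    (hmenu : ∀ w ∈ fccSlots, ⟪b.frame w, n⟫_ℝ = 0 ∨ ⟪b.frame w, n⟫_ℝ = Real.sqrt (2 / 3) ∨
      ⟪b.frame w, n⟫_ℝ = -Real.sqrt (2 / 3)) (k : ℕ) :
    ⟪nextNormal (forcedTop z b n k), (forcedTop z b n k).nrm⟫_ℝ = 1 / 3 := by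
  obtain ⟨hn', -, -, hpos⟩ := forcedTop_menu z b hn hmenu k
  exact inner_twoSlot_sub _ hn' hpos

/-! ### The forced ray as a model word -/

/-- Unfolding of the tree's `rayWord` two levels up, in terms of `nextNormal`:
`rayWord (k + 2) = F_k⁻¹ n_{k+1} :: rayWord (k + 1)`. -/
theorem rayWord_succ_succ (z : EuclideanSpace ℝ (Fin 3)) (b : WalkEntry) (n : EuclideanSpace ℝ (Fin 3)) (k : ℕ) :
    rayWord z b n (k + 2) = (forcedTop z b n k).frame.symm (nextNormal (forcedTop z b n k)) :: rayWord z b n (k + 1) :=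
  rfl

/-- The LAST letter of the ray word (the first push, applied first) is `b.frame⁻¹ n`. -/
theorem getLast?_rayWord_succ (z : EuclideanSpace ℝ (Fin 3)) (b : WalkEntry) (n : EuclideanSpace ℝ (Fin 3)) :
    ∀ k, (rayWord z b n (k + 1)).getLast? = some (b.frame.symm n)
  | 0 => rfl
  | k + 1 => by
    rw [rayWord_succ_succ, List.getLast?_cons, getLast?_rayWord_succ z b n k]; rfl

/-- The HEAD letter of the ray word is `−F_k⁻¹ n_k` (the top entry normal pulled back through the top frame, negated). -/
theorem head_rayWord (z : EuclideanSpace ℝ (Fin 3)) (b : WalkEntry) {n : EuclideanSpace ℝ (Fin 3)} (hn : ‖n‖ = 1)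
    (hmenu : ∀ w ∈ fccSlots, ⟪b.frame w, n⟫_ℝ = 0 ∨ ⟪b.frame w, n⟫_ℝ = Real.sqrt (2 / 3) ∨
      ⟪b.frame w, n⟫_ℝ = -Real.sqrt (2 / 3)) :
    ∀ k, ∃ tail, rayWord z b n (k + 1) = (-((forcedTop z b n k).frame.symm (forcedTop z b n k).nrm)) :: tail
  | 0 => ⟨[], by
      rw [rayWord_one, show (forcedTop z b n 0).frame = twinFrame b.frame n from rfl,
        show (forcedTop z b n 0).nrm = n from rfl, symm_twinFrame_self b.frame hn, neg_neg]⟩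
  | k + 1 => ⟨rayWord z b n (k + 1), by
      rw [rayWord_succ_succ, show (forcedTop z b n (k + 1)).frame =
          twinFrame (forcedTop z b n k).frame (nextNormal (forcedTop z b n k)) from rfl,
        show (forcedTop z b n (k + 1)).nrm = nextNormal (forcedTop z b n k) from rfl,
        symm_twinFrame_self _ (norm_nextNormal_forcedTop z b hn hmenu k), neg_neg]⟩

/-- **The forced ray's frames are word frames**: `F_k = wordFrame b.frame (rayWord z b n (k + 1))`. -/
theorem forcedTop_frame_eq_wordFrame (z : EuclideanSpace ℝ (Fin 3)) (b : WalkEntry) {n : EuclideanSpace ℝ (Fin 3)}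
    (hn : ‖n‖ = 1)
    (hmenu : ∀ w ∈ fccSlots, ⟪b.frame w, n⟫_ℝ = 0 ∨ ⟪b.frame w, n⟫_ℝ = Real.sqrt (2 / 3) ∨
      ⟪b.frame w, n⟫_ℝ = -Real.sqrt (2 / 3)) :
    ∀ k, (forcedTop z b n k).frame = wordFrame b.frame (rayWord z b n (k + 1))
  | 0 => by
    rw [rayWord_one, wordFrame_cons, show (forcedTop z b n 0).frame = twinFrame b.frame n from rfl]
    exact twinFrame_eq_reflection_trans b.frame hn
  | k + 1 => by
    rw [rayWord_succ_succ, wordFrame_cons, ← forcedTop_frame_eq_wordFrame z b hn hmenu k,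
      show (forcedTop z b n (k + 1)).frame = twinFrame (forcedTop z b n k).frame (nextNormal (forcedTop z b n k))
        from rfl]
    exact twinFrame_eq_reflection_trans _ (norm_nextNormal_forcedTop z b hn hmenu k)

/-- **Letters of the ray word**: unit model menu normals, consecutive letters at `−1/3`. -/
theorem rayWord_letters (z : EuclideanSpace ℝ (Fin 3)) (b : WalkEntry) {n : EuclideanSpace ℝ (Fin 3)} (hn : ‖n‖ = 1)
    (hmenu : ∀ w ∈ fccSlots, ⟪b.frame w, n⟫_ℝ = 0 ∨ ⟪b.frame w, n⟫_ℝ = Real.sqrt (2 / 3) ∨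
      ⟪b.frame w, n⟫_ℝ = -Real.sqrt (2 / 3)) :
    ∀ k, (∀ μ ∈ rayWord z b n (k + 1), ‖μ‖ = 1 ∧
        ∀ w ∈ fccSlots, ⟪w, μ⟫_ℝ = 0 ∨ ⟪w, μ⟫_ℝ = Real.sqrt (2 / 3) ∨ ⟪w, μ⟫_ℝ = -Real.sqrt (2 / 3)) ∧
      List.IsChain (fun μ μ' => ⟪μ, μ'⟫_ℝ = -1 / 3) (rayWord z b n (k + 1))
  | 0 => by
    rw [rayWord_one]
    refine ⟨fun μ hμ => ?_, List.isChain_singleton _⟩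
    rw [List.mem_singleton] at hμ
    subst hμ
    refine ⟨by rw [LinearIsometryEquiv.norm_map, hn], fun w hw => ?_⟩
    rw [← LinearIsometryEquiv.inner_map_map b.frame, LinearIsometryEquiv.apply_symm_apply]
    exact hmenu w hw
  | k + 1 => by
    obtain ⟨hlet, hchain⟩ := rayWord_letters z b hn hmenu k
    have hm := norm_nextNormal_forcedTop z b hn hmenu k
    have hmm := menu_nextNormal_forcedTop z b hn hmenu k
    refine ⟨fun μ hμ => ?_, ?_⟩
    · rw [rayWord_succ_succ, List.mem_cons] at hμ
      rcases hμ with rfl | h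
      · refine ⟨by rw [LinearIsometryEquiv.norm_map, hm], fun w hw => ?_⟩
        rw [← LinearIsometryEquiv.inner_map_map (forcedTop z b n k).frame, LinearIsometryEquiv.apply_symm_apply]
        exact hmm w hw
      · exact hlet μ h
    · obtain ⟨tail, htail⟩ := head_rayWord z b hn hmenu k
      rw [rayWord_succ_succ, List.isChain_cons]
      refine ⟨fun μ' hμ' => ?_, hchain⟩
      rw [htail, List.head?_cons, Option.mem_some_iff] at hμ'
      subst hμ'
      rw [inner_neg_right, LinearIsometryEquiv.inner_map_map, inner_nextNormal_forcedTop z b hn hmenu k]; norm_num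

/-- The ray word is an admissible reduced word in the tree's standard packaging (`±1/3` chain). -/
theorem rayWord_isChain (z : EuclideanSpace ℝ (Fin 3)) (b : WalkEntry) {n : EuclideanSpace ℝ (Fin 3)} (hn : ‖n‖ = 1)
    (hmenu : ∀ w ∈ fccSlots, ⟪b.frame w, n⟫_ℝ = 0 ∨ ⟪b.frame w, n⟫_ℝ = Real.sqrt (2 / 3) ∨
      ⟪b.frame w, n⟫_ℝ = -Real.sqrt (2 / 3)) (k : ℕ) :
    List.IsChain (fun μ μ' => ⟪μ, μ'⟫_ℝ = 1 / 3 ∨ ⟪μ, μ'⟫_ℝ = -1 / 3) (rayWord z b n (k + 1)) :=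
  (rayWord_letters z b hn hmenu k).2.imp fun _ _ h => Or.inr h

/-! ### Chain frames are word frames -/

/-- **Every chain frame is the frame of an admissible reduced word over the base**, empty or ending (first push,
applied first) with a letter adjacent to the launch slot: `F ∈ chainFrames z A u ⇒ F = wordFrame A κ` with unit model
menu letters at consecutive `−1/3` and `κ = []` or `κ.getLast? = some μ`, `⟪u, μ⟫ = √(2/3)`. -/
theorem exists_word_of_mem_chainFrames {z : EuclideanSpace ℝ (Fin 3)}
    {A F : EuclideanSpace ℝ (Fin 3) ≃ₗᵢ[ℝ] EuclideanSpace ℝ (Fin 3)} {u : EuclideanSpace ℝ (Fin 3)}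
    (hF : F ∈ chainFrames z A u) :
    ∃ κ : List (EuclideanSpace ℝ (Fin 3)), F = wordFrame A κ ∧
      (∀ μ ∈ κ, ‖μ‖ = 1 ∧
        ∀ w ∈ fccSlots, ⟪w, μ⟫_ℝ = 0 ∨ ⟪w, μ⟫_ℝ = Real.sqrt (2 / 3) ∨ ⟪w, μ⟫_ℝ = -Real.sqrt (2 / 3)) ∧
      List.IsChain (fun μ μ' => ⟪μ, μ'⟫_ℝ = -1 / 3) κ ∧
      (κ = [] ∨ ∃ μ, κ.getLast? = some μ ∧ ⟪u, μ⟫_ℝ = Real.sqrt (2 / 3)) := by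
  rcases hF with rfl | ⟨n, hn, hmenu, hpos, k, rfl⟩
  · exact ⟨[], rfl, fun μ hμ => by simp at hμ, List.isChain_nil, Or.inl rfl⟩
  · obtain ⟨hlet, hchain⟩ := rayWord_letters z ⟨A, u, 0⟩ hn hmenu k
    refine ⟨rayWord z ⟨A, u, 0⟩ n (k + 1), forcedTop_frame_eq_wordFrame z ⟨A, u, 0⟩ hn hmenu k, hlet, hchain,
      Or.inr ⟨A.symm n, getLast?_rayWord_succ z ⟨A, u, 0⟩ n k, ?_⟩⟩
    rw [← LinearIsometryEquiv.inner_map_map A, LinearIsometryEquiv.apply_symm_apply]; exact hpos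

/-- **Chain frames as lattices of words** (the form the capstones consume): `F·Λ₀ = (wordFrame A κ)·Λ₀`. -/
theorem exists_word_image_of_mem_chainFrames {z : EuclideanSpace ℝ (Fin 3)}
    {A F : EuclideanSpace ℝ (Fin 3) ≃ₗᵢ[ℝ] EuclideanSpace ℝ (Fin 3)} {u : EuclideanSpace ℝ (Fin 3)}
    (hF : F ∈ chainFrames z A u) :
    ∃ κ : List (EuclideanSpace ℝ (Fin 3)),
      F '' fccStacking 1 (Real.sqrt (2 / 3)) = (wordFrame A κ) '' fccStacking 1 (Real.sqrt (2 / 3)) ∧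
      (∀ μ ∈ κ, ‖μ‖ = 1 ∧
        ∀ w ∈ fccSlots, ⟪w, μ⟫_ℝ = 0 ∨ ⟪w, μ⟫_ℝ = Real.sqrt (2 / 3) ∨ ⟪w, μ⟫_ℝ = -Real.sqrt (2 / 3)) ∧
      List.IsChain (fun μ μ' => ⟪μ, μ'⟫_ℝ = 1 / 3 ∨ ⟪μ, μ'⟫_ℝ = -1 / 3) κ ∧
      (κ = [] ∨ ∃ μ, κ.getLast? = some μ ∧ ⟪u, μ⟫_ℝ = Real.sqrt (2 / 3)) := by
  obtain ⟨κ, rfl, hlet, hchain, hlast⟩ := exists_word_of_mem_chainFrames hF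
  exact ⟨κ, rfl, hlet, hchain.imp fun _ _ h => Or.inr h, hlast⟩

end Summit.Ventures.Crystal3D.Theorems

end
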